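import Summits.RiemannHypothesis.RiemannHypothesis.Theorems.PfPersistenceEdgeLawPohozaev
import HarnessLib

/-!
# The log-Pohozaev INEQUALITY and the defect formula (pub-rhpf theory-2, gen 4, Part E)

Mechanism/rigidity campaign; no RH claims. RH-free helper lemmas on the hypotheses of the tree
statement `PfPersistence.WeilLogPohozaevAt` (theory-1 R6).

`PfPersistenceEdgeLawPohozaev` proves `V = 2c₀·a·I` for a ground state with dilation virial `V`
and edge intensity `I` from TWO layer-regularity hypotheses: (R2) `L_a(u,h) = o(h)` (negligible
sub-layer-scale energy of the edge layer `σ_h`) and (R3) `D_a(t_η) = o(η)` (negligible interior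
dilation defect). This file separates the two:

* From the layer estimate alone (no regularity): `D_a(σ_h) ≥ c·h` eventually, for every `c < I`
  (`eventually_mul_le_windowDefectForm_weilEdgeLayer`; the local energy is `≥ 0`).
* Under (R3) alone the edge layer carries the WHOLE virial:
  `D_a(σ_{h(η)})/η → V` (`tendsto_windowDefectForm_weilEdgeLayer_layerDepth_div`; `√D_a` is a
  seminorm on the window class and `σ = t − w`, `w = t − σ`), hence the **log-Pohozaev
  inequality** `2c₀·a·I ≤ V` (`virial_ge_of_interiorRegular`): a positive edge intensity forces a
  positive virial, a critical window (`V = 0`) is edge-nodal (`I = 0`).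
* Under (R3) the sub-layer energy rate CONVERGES and equals the Pohozaev defect:
  `L_a(u,h)/h → V/a − I` (`tendsto_edgeLayerLocalEnergy_div_of_interiorRegular`). So, given (R3),
  hypothesis (R2) is EQUIVALENT to the identity `V = 2c₀·a·I`: the reduction of R6 localises the
  missing inequality `V ≤ 2c₀·a·I` as "no concentration of small-scale energy at the edge", it does
  not make it easier. (Honest label: (R2) ∧ (R3) ⟹ R6 and (R3) ∧ R6 ⟹ (R2).)

## References
* E. Bombieri, *Remarks on Weil's quadratic functional in the theory of prime numbers, I*,
  Rend. Mat. Acc. Lincei (9) 11 (2000) 183–233, §4 Thm 3, §6.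
-/

set_option linter.dupNamespace false

noncomputable section

open MeasureTheory Set Filter
open scoped Topology

namespace Summit.RiemannHypothesis.RiemannHypothesis.Theorems.PfPersistence

open Literature.NumberTheory.LFunctions
open Summit.RiemannHypothesis.RiemannHypothesis.Theorems.EvenWinsBeyondArch

variable {a : ℝ} {u v : ℝ → ℂ}

/-! ## Lower strip bound (no regularity) -/

/-- The local layer energy is non-negative. [folklore] -/
theorem edgeLayerLocalEnergy_nonneg (h : ℝ) : 0 ≤ edgeLayerLocalEnergy a u h :=
  setIntegral_nonneg measurableSet_Ioc fun _ ht ↦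
    mul_nonneg (weilArchDensity_pos ht.1).le (weilIncrement_nonneg _ _)

/-- An edge intensity is non-negative. [folklore] -/
theorem nonneg_of_hasEdgeIntensity {I : ℝ} (hI : HasEdgeIntensity v a I) : 0 ≤ I := by
  refine ge_of_tendsto hI ?_
  filter_upwards [Ioo_mem_nhdsGT one_pos] with r hr
  have hlog : 0 ≤ Real.log (1 / r) := Real.log_nonneg (one_le_one_div hr.1 hr.2.le)
  exact mul_nonneg (div_nonneg hlog hr.1.le) (setIntegral_nonneg
    (measurableSet_lt measurable_const continuous_abs.measurable) fun _ _ ↦ by positivity)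

/-- `(log(1/h) m_h − K m_h)/h → I` for an edge intensity `I` (`m_h/h → 0`). [folklore] -/
theorem tendsto_log_mul_edgeMass_sub_div {I : ℝ} (hI : HasEdgeIntensity v a I) (K : ℝ) :
    Tendsto (fun h ↦ (Real.log (1 / h) * edgeMass v a h - K * edgeMass v a h) / h) (𝓝[>] 0)
      (𝓝 I) := by
  have h1 : Tendsto (fun h ↦ Real.log (1 / h) / h * edgeMass v a h) (𝓝[>] 0) (𝓝 I) := hI
  have h2 := (tendsto_edgeMass_div hI).const_mul K
  rw [mul_zero] at h2
  have h3 := h1.sub h2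
  rw [sub_zero] at h3
  refine h3.congr' ?_
  filter_upwards [self_mem_nhdsWithin] with h (hh : 0 < h)
  field_simp

/-- **Lower strip bound.** For a ground state with edge intensity `I` and every `c < I`:
eventually (`h → 0⁺`) `c·h ≤ D_a(σ_h)` — from the layer estimate
`D_a(σ_h) ≥ log(1/h) m_h + L_a(u,h) − K_a m_h` with `L_a ≥ 0`; no regularity needed (the layers have
finite energy, `integrableOn_arch_weilEdgeLayer`). [cite: Bombieri2000Weil, §4 Thm 3] -/
theorem eventually_mul_le_windowDefectForm_weilEdgeLayer (hu : IsWeilGroundState a u) {I c : ℝ}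
    (hI : HasEdgeIntensity u a I) (hc : c < I) :
    ∀ᶠ h in 𝓝[>] 0, c * h ≤ windowDefectForm a (weilEdgeLayer a u h) := by
  have ht := tendsto_log_mul_edgeMass_sub_div (hasEdgeIntensity_weilTrunc hu hI) (layerConstant a)
  filter_upwards [ht.eventually (Ioi_mem_nhds hc),
    Ioc_mem_nhdsGT (half_pos (lt_min hu.pos one_pos))] with h hgt hh
  have hest := windowDefectForm_weilEdgeLayer_estimate hu hh.1 hh.2
    (integrableOn_arch_weilEdgeLayer hu h)
  have hL := edgeLayerLocalEnergy_nonneg (a := a) (u := u) h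
  rw [abs_le] at hest
  have hgt' := (lt_div_iff₀ hh.1).1 (show c < _ from hgt)
  linarith [hest.1]

/-! ## The layer carries the whole virial under interior regularity -/

/-- `σ_{h(η)} = t_η + (−1)•w_η`. [folklore] -/
theorem weilEdgeLayer_eq_interior_add_smul (η : ℝ) :
    weilEdgeLayer a u (layerDepth a η) =
      weilInteriorDefect a u η + (-1 : ℝ) • weilDilationDefect a u η := by
  funext x
  simp only [weilInteriorDefect, Pi.add_apply, Pi.neg_apply, neg_one_smul]
  ring

/-- **Under (R3) the edge layer carries the whole virial**: if `D_a(t_η)/η → 0` then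
`D_a(σ_{h(η)})/η → V`. Both directions of the seminorm triangle inequality for `√D_a`:
`√D(σ) ≤ √D(t) + √D(w)` and `√D(w) ≤ √D(t) + √D(σ)`, with `D(w_η)/η → V`.
[cite: Bombieri2000Weil, §4 Thm 3, §6] -/
theorem tendsto_windowDefectForm_weilEdgeLayer_layerDepth_div (hu : IsWeilGroundState a u)
    {V : ℝ} (hV : HasDerivAt (weilDilationProfile a u) V 0)
    (htail : Tendsto (fun η ↦ windowDefectForm a (weilInteriorDefect a u η) / η)
      (𝓝[>] 0) (𝓝 0)) :
    Tendsto (fun η ↦ windowDefectForm a (weilEdgeLayer a u (layerDepth a η)) / η) (𝓝[>] 0)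
      (𝓝 V) := by
  have ha : 0 < a := hu.pos
  have h1 := tendsto_windowDefectForm_weilDilationDefect_div hu hV
  have hV0 : 0 ≤ V := virial_nonneg_of_hasDerivAt hu hV
  -- notation-free abbreviations
  set T : ℝ → ℝ := fun η ↦ windowDefectForm a (weilInteriorDefect a u η) / η with hT
  set W : ℝ → ℝ := fun η ↦ windowDefectForm a (weilDilationDefect a u η) / η with hW
  set S : ℝ → ℝ := fun η ↦ windowDefectForm a (weilEdgeLayer a u (layerDepth a η)) / η with hS
  -- eventually: all three are `≥ 0` and the two triangle inequalities hold
  have hev : ∀ᶠ η in 𝓝[>] 0, 0 ≤ T η ∧ 0 ≤ W η ∧ 0 ≤ S η ∧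
      S η ≤ (Real.sqrt (T η) + Real.sqrt (W η)) ^ 2 ∧
      W η ≤ (Real.sqrt (T η) + Real.sqrt (S η)) ^ 2 := by
    filter_upwards [Ioc_mem_nhdsGT zero_lt_one] with η hη
    have hσ2 := memLp_weilEdgeLayer hu (layerDepth a η)
    have hσs : ∀ x, a ≤ |x| → weilEdgeLayer a u (layerDepth a η) x = 0 := fun _ hx ↦
      weilEdgeLayer_eq_zero_of_le_abs _ hx
    have hσE := integrableOn_arch_weilEdgeLayer hu (layerDepth a η)
    have hw2 : MemLp (weilDilationDefect a u η) 2 :=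
      memLp_weilDilationDefect hu.memLp (by linarith [hη.1])
    have hws : ∀ x, a ≤ |x| → weilDilationDefect a u η x = 0 := fun _ hx ↦
      weilDilationDefect_eq_zero ha.le hη.1.le hx
    have hwE := integrableOn_arch_weilDilationDefect hu hη.1.le hη.2
    have ht2 : MemLp (weilInteriorDefect a u η) 2 := hw2.add hσ2
    have hts : ∀ x, a ≤ |x| → weilInteriorDefect a u η x = 0 := fun x hx ↦ by
      rw [weilInteriorDefect, Pi.add_apply, hws x hx, hσs x hx, add_zero]
    have htE : IntegrableOn (fun t ↦ weilArchDensity t *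
        weilIncrement (weilInteriorDefect a u η) t) (Ioi 0) :=
      dt_finiteEnergy_add hw2 hσ2 hwE hσE
    have hDt := windowDefectForm_nonneg ha ht2 hts htE
    have hDw := windowDefectForm_nonneg ha hw2 hws hwE
    have hDσ := windowDefectForm_nonneg ha hσ2 hσs hσE
    -- the two polarisations and Cauchy–Schwarz
    have hpolσ := windowDefectForm_add_smul ht2 hw2 hts hws htE hwE (-1)
    rw [← weilEdgeLayer_eq_interior_add_smul] at hpolσ
    have hcsσ := windowDefectForm₂_sq_le ha ht2 hw2 hts hws htE hwE
    have hpolw := windowDefectForm_add_smul ht2 hσ2 hts hσs htE hσE (-1)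
    rw [← weilDilationDefect_eq_interior_add_smul] at hpolw
    have hcsw := windowDefectForm₂_sq_le ha ht2 hσ2 hts hσs htE hσE
    -- `|D₂| ≤ √D √D`
    have key : ∀ {P Q R : ℝ}, 0 ≤ P → 0 ≤ Q → R ^ 2 ≤ P * Q →
        P + 2 * (-1) * R + (-1) ^ 2 * Q ≤ (Real.sqrt P + Real.sqrt Q) ^ 2 := by
      intro P Q R hP hQ hR
      have hs : Real.sqrt (R ^ 2) ≤ Real.sqrt (P * Q) := Real.sqrt_le_sqrt hR
      rw [Real.sqrt_sq_eq_abs, Real.sqrt_mul hP] at hs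
      have h1 : -R ≤ Real.sqrt P * Real.sqrt Q := (neg_le_abs R).trans hs
      nlinarith [Real.sq_sqrt hP, Real.sq_sqrt hQ, h1]
    have hpos : 0 < η := hη.1
    refine ⟨div_nonneg hDt hpos.le, div_nonneg hDw hpos.le, div_nonneg hDσ hpos.le, ?_, ?_⟩
    · have h := key hDt hDw hcsσ
      rw [← hpolσ] at h
      simp only [hT, hW, hS]
      rw [Real.sqrt_div' _ hpos.le, Real.sqrt_div' _ hpos.le, ← add_div, div_pow,
        Real.sq_sqrt hpos.le]
      exact div_le_div_of_nonneg_right h hpos.le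
    · have h := key hDt hDσ hcsw
      rw [← hpolw] at h
      simp only [hT, hW, hS]
      rw [Real.sqrt_div' _ hpos.le, Real.sqrt_div' _ hpos.le, ← add_div, div_pow,
        Real.sq_sqrt hpos.le]
      exact div_le_div_of_nonneg_right h hpos.le
  -- upper bound: `S ≤ (√T + √W)² → (0 + √V)² = V`
  have hup : Tendsto (fun η ↦ (Real.sqrt (T η) + Real.sqrt (W η)) ^ 2) (𝓝[>] 0) (𝓝 V) := by
    have := ((htail.sqrt).add (h1.sqrt)).pow 2
    rw [Real.sqrt_zero, zero_add, Real.sq_sqrt hV0] at this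
    exact this
  -- so `S` is eventually bounded; lower bound via `√W − √T ≤ √S`
  -- squeeze on `√S`: `√W − √T ≤ √S ≤ √T + √W`
  have hsqS : Tendsto (fun η ↦ Real.sqrt (S η)) (𝓝[>] 0) (𝓝 (Real.sqrt V)) := by
    have hlo : Tendsto (fun η ↦ Real.sqrt (W η) - Real.sqrt (T η)) (𝓝[>] 0)
        (𝓝 (Real.sqrt V)) := by
      have := (h1.sqrt).sub (htail.sqrt)
      rw [Real.sqrt_zero, sub_zero] at this
      exact this
    have hhi : Tendsto (fun η ↦ Real.sqrt (T η) + Real.sqrt (W η)) (𝓝[>] 0)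
        (𝓝 (Real.sqrt V)) := by
      have := (htail.sqrt).add (h1.sqrt)
      rw [Real.sqrt_zero, zero_add] at this
      exact this
    refine tendsto_of_tendsto_of_tendsto_of_le_of_le' hlo hhi ?_ ?_
    · filter_upwards [hev] with η hη
      obtain ⟨hT0, hW0, hS0, -, h2⟩ := hη
      have : Real.sqrt (W η) ≤ Real.sqrt (T η) + Real.sqrt (S η) := by
        rw [← Real.sqrt_sq (add_nonneg (Real.sqrt_nonneg _) (Real.sqrt_nonneg _))]
        exact Real.sqrt_le_sqrt h2
      linarith
    · filter_upwards [hev] with η hη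
      obtain ⟨hT0, hW0, hS0, h2, -⟩ := hη
      rw [← Real.sqrt_sq (add_nonneg (Real.sqrt_nonneg _) (Real.sqrt_nonneg _))]
      exact Real.sqrt_le_sqrt h2
  have := hsqS.pow 2
  rw [Real.sq_sqrt hV0] at this
  refine this.congr' ?_
  filter_upwards [hev] with η hη
  exact Real.sq_sqrt hη.2.2.1

/-- **The log-Pohozaev INEQUALITY from interior regularity alone**: if `D_a(t_η)/η → 0` then
`2c₀·a·I ≤ V` for every ground state with dilation virial `V` and edge intensity `I`
(`2c₀ = 1`). [cite: Bombieri2000Weil, §4 Thm 3, §6] -/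
theorem virial_ge_of_interiorRegular (hu : IsWeilGroundState a u) {V I : ℝ}
    (hV : HasDerivAt (weilDilationProfile a u) V 0) (hI : HasEdgeIntensity u a I)
    (htail : Tendsto (fun η ↦ windowDefectForm a (weilInteriorDefect a u η) / η)
      (𝓝[>] 0) (𝓝 0)) :
    2 * edgeLawKernelConstant * a * I ≤ V := by
  have ha : 0 < a := hu.pos
  have hS := tendsto_windowDefectForm_weilEdgeLayer_layerDepth_div hu hV htail
  have hdepth := tendsto_layerDepth ha
  -- for every `c < I`: `c·a ≤ V`
  have hc : ∀ c < I, c * a ≤ V := fun c hc ↦ by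
    have hev := hdepth.eventually (eventually_mul_le_windowDefectForm_weilEdgeLayer hu hI hc)
    have hlim : Tendsto (fun η ↦ c * (layerDepth a η / η)) (𝓝[>] 0) (𝓝 (c * a)) :=
      (tendsto_layerDepth_div a).const_mul c
    refine le_of_tendsto_of_tendsto hlim hS ?_
    filter_upwards [hev, self_mem_nhdsWithin] with η hη (hpos : 0 < η)
    rw [← mul_div_assoc]
    exact div_le_div_of_nonneg_right hη hpos.le
  have hIa : I ≤ V / a := le_of_forall_lt_imp_le_of_dense fun c hc' ↦ by
    rw [le_div_iff₀ ha]
    exact hc c hc'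
  rw [edgeLawKernelConstant]
  have := (le_div_iff₀ ha).1 hIa
  linarith

/-- Under interior regularity a POSITIVE EDGE INTENSITY FORCES A POSITIVE VIRIAL (no critical
window at `a` for this ground state). [folklore] -/
theorem virial_pos_of_interiorRegular (hu : IsWeilGroundState a u) {V I : ℝ}
    (hV : HasDerivAt (weilDilationProfile a u) V 0) (hI : HasEdgeIntensity u a I)
    (htail : Tendsto (fun η ↦ windowDefectForm a (weilInteriorDefect a u η) / η)
      (𝓝[>] 0) (𝓝 0)) (hI0 : 0 < I) : 0 < V := by
  have h := virial_ge_of_interiorRegular hu hV hI htail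
  rw [edgeLawKernelConstant] at h
  nlinarith [hu.pos]

/-- Under interior regularity a CRITICAL WINDOW (`V = 0`) is EDGE-NODAL (`I = 0`). [folklore] -/
theorem edgeIntensity_eq_zero_of_interiorRegular (hu : IsWeilGroundState a u) {V I : ℝ}
    (hV : HasDerivAt (weilDilationProfile a u) V 0) (hI : HasEdgeIntensity u a I)
    (htail : Tendsto (fun η ↦ windowDefectForm a (weilInteriorDefect a u η) / η)
      (𝓝[>] 0) (𝓝 0)) (hV0 : V = 0) : I = 0 := by
  have h := virial_ge_of_interiorRegular hu hV hI htail
  rw [edgeLawKernelConstant, hV0] at h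
  have hI0 := nonneg_of_hasEdgeIntensity hI
  nlinarith [hu.pos]

/-! ## The defect formula: the sub-layer energy rate converges under (R3) -/

/-- The inverse of the layer depth: `η(h) = h/(a − h)` has `h(η(h)) = h` (`h ≠ a`, `a ≠ 0`).
[folklore] -/
theorem layerDepth_div_sub (ha : a ≠ 0) {h : ℝ} (hh : h ≠ a) :
    layerDepth a (h / (a - h)) = h := by
  have hah : a - h ≠ 0 := sub_ne_zero.2 (Ne.symm hh)
  have h1 : 1 + h / (a - h) = a / (a - h) := by
    field_simp
    ring
  rw [layerDepth, h1, mul_div_assoc', div_div_div_cancel_right₀ hah, mul_div_cancel_left₀ _ ha]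

/-- `η(h) = h/(a − h) → 0⁺` as `h → 0⁺` (`a > 0`). [folklore] -/
theorem tendsto_div_sub_nhdsGT (ha : 0 < a) :
    Tendsto (fun h : ℝ ↦ h / (a - h)) (𝓝[>] 0) (𝓝[>] 0) := by
  have hcont : Tendsto (fun h : ℝ ↦ h / (a - h)) (𝓝 0) (𝓝 0) := by
    have : Tendsto (fun h : ℝ ↦ h / (a - h)) (𝓝 0) (𝓝 (0 / (a - 0))) :=
      tendsto_id.div (tendsto_const_nhds.sub tendsto_id) (by simpa using ha.ne')
    simpa using this
  refine tendsto_nhdsWithin_iff.2 ⟨hcont.mono_left nhdsWithin_le_nhds, ?_⟩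
  filter_upwards [Ioo_mem_nhdsGT ha] with h hh
  exact div_pos hh.1 (by linarith [hh.2])

/-- **The defect formula.** Under interior regularity (R3), for a ground state with virial `V`
and edge intensity `I`, the sub-layer-scale energy rate CONVERGES:
`L_a(u,h)/h → V/a − I` (`h → 0⁺`). Hence, given (R3), hypothesis (R2) `L_a(u,h)/h → 0` is
EQUIVALENT to the log-Pohozaev identity `V = a·I`: the Pohozaev defect `V − 2c₀aI` is `a` times
the concentration rate of small-scale energy at the edge. [cite: Bombieri2000Weil, §4 Thm 3, §6] -/
theorem tendsto_edgeLayerLocalEnergy_div_of_interiorRegular (hu : IsWeilGroundState a u)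
    {V I : ℝ} (hV : HasDerivAt (weilDilationProfile a u) V 0) (hI : HasEdgeIntensity u a I)
    (htail : Tendsto (fun η ↦ windowDefectForm a (weilInteriorDefect a u η) / η)
      (𝓝[>] 0) (𝓝 0)) :
    Tendsto (fun h ↦ edgeLayerLocalEnergy a u h / h) (𝓝[>] 0) (𝓝 (V / a - I)) := by
  have ha : 0 < a := hu.pos
  -- `D_a(σ_h)/h → V/a` along `h`, by reparametrising `η = h/(a − h)`
  have hS := (tendsto_windowDefectForm_weilEdgeLayer_layerDepth_div hu hV htail).comp
    (tendsto_div_sub_nhdsGT ha)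
  have hDσ : Tendsto (fun h ↦ windowDefectForm a (weilEdgeLayer a u h) / h) (𝓝[>] 0)
      (𝓝 (V / a)) := by
    have hfac : Tendsto (fun h : ℝ ↦ 1 / (a - h)) (𝓝[>] 0) (𝓝 (1 / a)) := by
      have : Tendsto (fun h : ℝ ↦ 1 / (a - h)) (𝓝 0) (𝓝 (1 / (a - 0))) :=
        tendsto_const_nhds.div (tendsto_const_nhds.sub tendsto_id) (by simpa using ha.ne')
      rw [sub_zero] at this
      exact this.mono_left nhdsWithin_le_nhds
    have := hS.mul hfac
    rw [show V * (1 / a) = V / a by ring] at this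
    refine this.congr' ?_
    filter_upwards [Ioo_mem_nhdsGT ha] with h hh
    have hah : a - h ≠ 0 := by linarith [hh.2]
    rw [Function.comp_apply, layerDepth_div_sub ha.ne' hh.2.ne]
    field_simp
  -- `(log(1/h) m_h − K m_h)/h`-type control: `|D(σ_h) − (log(1/h)m_h + L)| ≤ K m_h`
  have hm := tendsto_log_mul_edgeMass_sub_div (hasEdgeIntensity_weilTrunc hu hI) 0
  have hm0 := (tendsto_edgeMass_div (hasEdgeIntensity_weilTrunc hu hI)).const_mul
    (layerConstant a)
  rw [mul_zero] at hm0
  -- squeeze `L/h − (D(σ_h)/h − log(1/h)m_h/h)` between `∓ K m_h/h`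
  have hdiff : Tendsto (fun h ↦ edgeLayerLocalEnergy a u h / h -
      (windowDefectForm a (weilEdgeLayer a u h) / h -
        (Real.log (1 / h) * edgeMass (weilTrunc a u) a h -
          0 * edgeMass (weilTrunc a u) a h) / h)) (𝓝[>] 0) (𝓝 0) := by
    refine squeeze_zero_norm' ?_ hm0
    filter_upwards [Ioc_mem_nhdsGT (half_pos (lt_min ha one_pos))] with h hh
    have hest := windowDefectForm_weilEdgeLayer_estimate hu hh.1 hh.2
      (integrableOn_arch_weilEdgeLayer hu h)
    rw [zero_mul, sub_zero, Real.norm_eq_abs, ← sub_div, ← sub_div, abs_div, abs_of_pos hh.1,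
      div_le_iff₀ hh.1]
    rw [abs_sub_comm] at hest
    calc |edgeLayerLocalEnergy a u h - (windowDefectForm a (weilEdgeLayer a u h) -
          Real.log (1 / h) * edgeMass (weilTrunc a u) a h)|
        = |Real.log (1 / h) * edgeMass (weilTrunc a u) a h + edgeLayerLocalEnergy a u h -
            windowDefectForm a (weilEdgeLayer a u h)| := by ring_nf
      _ ≤ layerConstant a * edgeMass (weilTrunc a u) a h := hest
      _ = layerConstant a * (edgeMass (weilTrunc a u) a h / h) * h := by
          rw [mul_assoc, div_mul_cancel₀ _ hh.1.ne']
  have := hdiff.add (hDσ.sub hm)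
  rw [zero_add] at this
  refine this.congr' (Eventually.of_forall fun h ↦ ?_)
  ring

end Summit.RiemannHypothesis.RiemannHypothesis.Theorems.PfPersistence

end
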